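import Summits.QuantumFields.YangMills.Theorems.UnitScaleTiltProp8FlatOpsLettersAssembly
import Literature.MathematicalPhysics.QuantumFieldTheory.Balaban1983to89.B6Prop26ReachTransplant
import HarnessLib

/-!
# Route `UnitScaleTilt`, crux K1 «MinimiserStabilityRegPr» (stmt-QuantumFields-19200), stub V2′ `stub_halvingStep` (H) — **THE TWO (46) ROWS OF THE MATRIX (KERNEL)
# EXTENSION OF P2's FLAT `H`, IN THE DRESSING∕P1-DISPLAY BINDER SHAPE** (unweighted matrix data `‖X c‖ ≤ t`, UNGUARDED `t`, weights `w 1` and `w 2·L^{K−n}`)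

Cell `ym3-torus` (HUMAN RULING D-0037: YM ladder rung R3 — not the Clay problem), width seat `ym-ust-19200-w3` gen 4 (default offer 06:34Z, chart-agnostic under RULING g26-№5:
P2's `flatH` is the chart-`H` itself under (R1) and is the `H` of ✓`HalvingChartP1Display.sliceAndSizes_of_P1rows`∕✓`row165_of_tracePairing_L5_anyW` today).
`--supports stmt-QuantumFields-19200 --as helper`; def-free, 0 sorry.

THE POINT.  P2's record letter `FlatCubeOpsText.HSupLetterG F n K D w H₀ B₀` ((46) of [Balaban1985Variational]) speaks of REAL data `Xr : BondIdx D → ℝ` with the LEVEL-WEIGHTED size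
`(L^{j(c)}η)|Xr c| ≤ t`, GUARDED by `0 ≤ t`.  The consumers on the (165)-A₁ chain (`FlatProp4Dressing.hWq_of_dressing`'s `hH`, ✓p607709, ✓`sliceAndSizes_of_P1rows`'s `hH hH'`)
speak of MATRIX data `X : BondIdx D → M₂(ℂ)` fed to the kernel extension `X ↦ (b ↦ Σ_c (H₀ e_c)(b) • X c)`, with the UNWEIGHTED size `‖X c‖ ≤ t` and NO guard.  The passage:
(i) the sign-data trick of `ChartHInvLetter.letter_Y` (`‖Σ_c K_c•X_c‖ ≤ Σ_c |K_c|·t = H₀(t·sgn K)(b)` with `K_c = (H₀ e_c)(b)` resp. its difference across `b ↦ b+e_ν`);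
(ii) `L^{j(c)}η ≤ 1` for index levels `j(c) ≤ k = K − n`, so unweighted size `t` implies weighted size `t`; (iii) `0 ≤ t` from `‖X c₀‖ ≤ t` at ANY index bond `c₀` — hence the
hypothesis `Nonempty (BondIdx D)` (for the empty index set and `t < 0` the unguarded letter is false).

WHAT THIS FILE PROVES (theorems only): `levFactor_le_one`, `apply_eq_sum_kernel` (`H₀ Xr b = Σ_c Xr c·(H₀ e_c)(b)`), ★`supRow_kernelExt` and ★`gradRow_kernelExt` (the two rows
for ANY real `H₀` with `HSupLetterG`, guarded), ★★`twoRows_kernelExt_unguarded` (both rows UNGUARDED under `Nonempty (BondIdx D)`), and the `flatH` instances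
★★`hH_flatH_of_rowsAt`-style readings: `twoRows_flatH_unguarded` from `HSupLetterG F n K D w (flatH F n K D) B₀` (the first entry of P2's `RowsAt`).
HONEST SCOPE: bookkeeping over P2's displayed∕ported letter; nothing of Bałaban's estimates is proved here; NOT a claim about the stub, the crux, the rung or the mass gap.

References: T. Bałaban, CMP **102** (1985) 277–309 [Balaban1985Variational] ((46) p.285, (157) p.302, (165) p.304); CMP **96** (1984) 223–250 [Balaban1984PropagatorsII]
(Cor. 2.8 (2.150)–(2.151) p.249).  (`B6Prop26ReachTransplant` is imported only for the tree's global `DecidableEq (PBond _ _)`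
instance, so that the `Pi.single` terms here are the consumers' verbatim.)
-/

set_option autoImplicit false

noncomputable section

open scoped BigOperators Matrix.Norms.L2Operator

namespace Summit.QuantumFields.YangMills.Theorems.FlatHDressingShape

open Literature.MathematicalPhysics.QuantumFieldTheory.Balaban1983to89
open B6SectADomainsV1 (Domains)
open B6SectAOperatorsV1 (BondIdx)
open T3ContinuumYM3Torus (T3Family)
open Summit.QuantumFields.YangMills.Theorems.FlatCubeOpsText (IsLevWeight HSupLetterG)
open Summit.QuantumFields.YangMills.Theorems.FlatOpsLettersAssembly (flatH levWeight_nonneg)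

variable (F : T3Family) (n K : ℕ) (D : Domains (F.P K))

/-- The level factor of an index bond is at most one: `L^{j(c)}·L^{−(K−n)} ≤ 1` for `j(c) ≤ D.k ≤ K − n`. [cite: Balaban1985Variational, (46) p.285] -/
theorem levFactor_le_one (hDk : D.k ≤ K - n) (c : BondIdx D) : (F.L : ℝ) ^ (c.1.1 : ℕ) * ((F.L : ℝ)⁻¹) ^ (K - n) ≤ 1 := by
  have hL1 : (1 : ℝ) ≤ F.L := by exact_mod_cast F.hL.2.le
  have hL0 : (0 : ℝ) < F.L := by positivity
  have hj : (c.1.1 : ℕ) ≤ K - n := (Nat.le_of_lt_succ c.1.1.isLt).trans hDk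
  rw [inv_pow, ← div_eq_mul_inv, div_le_one (by positivity)]
  exact pow_le_pow_right₀ hL1 hj

/-- A real linear functional of finitely supported data is its kernel sum: `H₀ Xr b = Σ_c Xr c · (H₀ e_c)(b)`. [folklore] -/
theorem apply_eq_sum_kernel (H₀ : (BondIdx D → ℝ) →ₗ[ℝ] (PBond (F.P K) 0 → ℝ)) (Xr : BondIdx D → ℝ) (b : PBond (F.P K) 0) :
    H₀ Xr b = ∑ c, Xr c * H₀ (Pi.single c 1) b := by
  classical
  have hdec : Xr = ∑ c, Xr c • (Pi.single c (1 : ℝ) : BondIdx D → ℝ) := by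
    funext c'
    simp only [Finset.sum_apply, Pi.smul_apply, Pi.single_apply, smul_eq_mul, mul_ite, mul_one, mul_zero]
    rw [Finset.sum_ite_eq]; simp
  conv_lhs => rw [hdec]
  rw [map_sum, Finset.sum_apply]
  refine Finset.sum_congr rfl fun c _ => ?_
  rw [map_smul, Pi.smul_apply, smul_eq_mul]

/-- **THE SUP ROW OF THE KERNEL EXTENSION** (guarded): `w 1 b·‖Σ_c (H₀ e_c)(b)•X c‖ ≤ B₀·t` for `‖X c‖ ≤ t`, `0 ≤ t`, from `HSupLetterG`'s first row on the sign data
`t·sgn((H₀ e_c)(b))`. [cite: Balaban1985Variational, (46) p.285] -/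
theorem supRow_kernelExt (hDk : D.k ≤ K - n) (w : ℕ → PBond (F.P K) 0 → ℝ) (hw1 : ∀ b, 0 ≤ w 1 b) (H₀ : (BondIdx D → ℝ) →ₗ[ℝ] (PBond (F.P K) 0 → ℝ))
    {B₀ : ℝ} (hsup : HSupLetterG F n K D w H₀ B₀) (X : BondIdx D → Matrix (Fin 2) (Fin 2) ℂ) {t : ℝ} (ht : 0 ≤ t) (hX : ∀ c, ‖X c‖ ≤ t)
    (b : PBond (F.P K) 0) : w 1 b * ‖∑ c, H₀ (Pi.single c 1) b • X c‖ ≤ B₀ * t := by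
  classical
  set Kc : BondIdx D → ℝ := fun c => H₀ (Pi.single c 1) b with hKc
  set Xr : BondIdx D → ℝ := fun c => if 0 ≤ Kc c then t else -t with hXr
  have hXr_abs : ∀ c, |Xr c| = t := fun c => by
    simp only [hXr]; split_ifs
    · exact abs_of_nonneg ht
    · rw [abs_neg, abs_of_nonneg ht]
  have hXr_w : ∀ c, ((F.L : ℝ) ^ (c.1.1 : ℕ) * ((F.L : ℝ)⁻¹) ^ (K - n)) * |Xr c| ≤ t := fun c => by
    rw [hXr_abs]
    calc ((F.L : ℝ) ^ (c.1.1 : ℕ) * ((F.L : ℝ)⁻¹) ^ (K - n)) * t ≤ 1 * t := mul_le_mul_of_nonneg_right (levFactor_le_one F n K D hDk c) ht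
      _ = t := one_mul t
  have hKX : ∀ c, Xr c * Kc c = |Kc c| * t := fun c => by
    simp only [hXr]; split_ifs with h
    · rw [abs_of_nonneg h, mul_comm]
    · rw [abs_of_neg (not_le.mp h)]; ring
  have hsum : H₀ Xr b = ∑ c, |Kc c| * t := by
    rw [apply_eq_sum_kernel F K D H₀ Xr b]
    exact Finset.sum_congr rfl fun c _ => hKX c
  have h1 : ‖∑ c, H₀ (Pi.single c 1) b • X c‖ ≤ ∑ c, |Kc c| * t := by
    refine (norm_sum_le _ _).trans (Finset.sum_le_sum fun c _ => ?_)
    rw [norm_smul, Real.norm_eq_abs]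
    exact mul_le_mul_of_nonneg_left (hX c) (abs_nonneg _)
  calc w 1 b * ‖∑ c, H₀ (Pi.single c 1) b • X c‖ ≤ w 1 b * ∑ c, |Kc c| * t := mul_le_mul_of_nonneg_left h1 (hw1 b)
    _ = w 1 b * H₀ Xr b := by rw [hsum]
    _ ≤ w 1 b * |H₀ Xr b| := mul_le_mul_of_nonneg_left (le_abs_self _) (hw1 b)
    _ ≤ B₀ * t := (hsup Xr t ht hXr_w).1 b

/-- **THE GRADIENT ROW OF THE KERNEL EXTENSION** (guarded): `w 2 b·L^{K−n}·‖Σ_c (H₀ e_c)(b+e_ν)•X c − Σ_c (H₀ e_c)(b)•X c‖ ≤ B₀·t` for `‖X c‖ ≤ t`, `0 ≤ t`, from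
`HSupLetterG`'s second row on the sign data of the kernel DIFFERENCE. [cite: Balaban1985Variational, (46) p.285] -/
theorem gradRow_kernelExt (hDk : D.k ≤ K - n) (w : ℕ → PBond (F.P K) 0 → ℝ) (hw2 : ∀ b, 0 ≤ w 2 b) (H₀ : (BondIdx D → ℝ) →ₗ[ℝ] (PBond (F.P K) 0 → ℝ))
    {B₀ : ℝ} (hsup : HSupLetterG F n K D w H₀ B₀) (X : BondIdx D → Matrix (Fin 2) (Fin 2) ℂ) {t : ℝ} (ht : 0 ≤ t) (hX : ∀ c, ‖X c‖ ≤ t)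
    (b : PBond (F.P K) 0) (ν : Fin 3) :
    w 2 b * (F.L : ℝ) ^ (K - n) * ‖(∑ c, H₀ (Pi.single c 1) ⟨b.src.shift ν, b.dir⟩ • X c) - ∑ c, H₀ (Pi.single c 1) b • X c‖ ≤ B₀ * t := by
  classical
  set b' : PBond (F.P K) 0 := ⟨b.src.shift ν, b.dir⟩ with hb'
  set Kc : BondIdx D → ℝ := fun c => H₀ (Pi.single c 1) b' - H₀ (Pi.single c 1) b with hKc
  set Xr : BondIdx D → ℝ := fun c => if 0 ≤ Kc c then t else -t with hXr
  have hXr_abs : ∀ c, |Xr c| = t := fun c => by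
    simp only [hXr]; split_ifs
    · exact abs_of_nonneg ht
    · rw [abs_neg, abs_of_nonneg ht]
  have hXr_w : ∀ c, ((F.L : ℝ) ^ (c.1.1 : ℕ) * ((F.L : ℝ)⁻¹) ^ (K - n)) * |Xr c| ≤ t := fun c => by
    rw [hXr_abs]
    calc ((F.L : ℝ) ^ (c.1.1 : ℕ) * ((F.L : ℝ)⁻¹) ^ (K - n)) * t ≤ 1 * t := mul_le_mul_of_nonneg_right (levFactor_le_one F n K D hDk c) ht
      _ = t := one_mul t
  have hKX : ∀ c, Xr c * Kc c = |Kc c| * t := fun c => by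
    simp only [hXr]; split_ifs with h
    · rw [abs_of_nonneg h, mul_comm]
    · rw [abs_of_neg (not_le.mp h)]; ring
  have hsum : H₀ Xr b' - H₀ Xr b = ∑ c, |Kc c| * t := by
    rw [apply_eq_sum_kernel F K D H₀ Xr b', apply_eq_sum_kernel F K D H₀ Xr b, ← Finset.sum_sub_distrib]
    refine Finset.sum_congr rfl fun c _ => ?_
    rw [← mul_sub]; exact hKX c
  have hdiff : (∑ c, H₀ (Pi.single c 1) b' • X c) - ∑ c, H₀ (Pi.single c 1) b • X c = ∑ c, Kc c • X c := by
    rw [← Finset.sum_sub_distrib]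
    refine Finset.sum_congr rfl fun c _ => ?_
    rw [← sub_smul]
  have h1 : ‖(∑ c, H₀ (Pi.single c 1) b' • X c) - ∑ c, H₀ (Pi.single c 1) b • X c‖ ≤ ∑ c, |Kc c| * t := by
    rw [hdiff]
    refine (norm_sum_le _ _).trans (Finset.sum_le_sum fun c _ => ?_)
    rw [norm_smul, Real.norm_eq_abs]
    exact mul_le_mul_of_nonneg_left (hX c) (abs_nonneg _)
  have hw0 : 0 ≤ w 2 b * (F.L : ℝ) ^ (K - n) := mul_nonneg (hw2 b) (by positivity)
  calc w 2 b * (F.L : ℝ) ^ (K - n) * ‖(∑ c, H₀ (Pi.single c 1) b' • X c) - ∑ c, H₀ (Pi.single c 1) b • X c‖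
      ≤ w 2 b * (F.L : ℝ) ^ (K - n) * ∑ c, |Kc c| * t := mul_le_mul_of_nonneg_left h1 hw0
    _ = w 2 b * (F.L : ℝ) ^ (K - n) * (H₀ Xr b' - H₀ Xr b) := by rw [hsum]
    _ ≤ w 2 b * (F.L : ℝ) ^ (K - n) * |H₀ Xr b' - H₀ Xr b| := mul_le_mul_of_nonneg_left (le_abs_self _) hw0
    _ ≤ B₀ * t := (hsup Xr t ht hXr_w).2 b ν

/-- **BOTH ROWS, UNGUARDED, FOR ANY REAL `H₀` WITH `HSupLetterG`** on a NONEMPTY index set (then `‖X c₀‖ ≤ t` forces `0 ≤ t`): exactly the `hH`∕`hH'` binders of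
✓`HalvingChartP1Display.sliceAndSizes_of_P1rows` and (bundled) the `hH` binder of `FlatProp4Dressing.hWq_of_dressing` at the kernel extension of `H₀`.
[cite: Balaban1985Variational, (46) p.285, (158) p.302, (165) p.304] -/
theorem twoRows_kernelExt_unguarded (hDk : D.k ≤ K - n) (w : ℕ → PBond (F.P K) 0 → ℝ) (hw1 : ∀ b, 0 ≤ w 1 b) (hw2 : ∀ b, 0 ≤ w 2 b)
    (H₀ : (BondIdx D → ℝ) →ₗ[ℝ] (PBond (F.P K) 0 → ℝ)) {B₀ : ℝ} (hsup : HSupLetterG F n K D w H₀ B₀) (hne : Nonempty (BondIdx D)) :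
    (∀ (X : BondIdx D → Matrix (Fin 2) (Fin 2) ℂ) (t : ℝ), (∀ c, ‖X c‖ ≤ t) → ∀ b, w 1 b * ‖∑ c, H₀ (Pi.single c 1) b • X c‖ ≤ B₀ * t) ∧
    ∀ (X : BondIdx D → Matrix (Fin 2) (Fin 2) ℂ) (t : ℝ), (∀ c, ‖X c‖ ≤ t) → ∀ (b : PBond (F.P K) 0) (ν : Fin 3),
      w 2 b * (F.L : ℝ) ^ (K - n) * ‖(∑ c, H₀ (Pi.single c 1) ⟨b.src.shift ν, b.dir⟩ • X c) - ∑ c, H₀ (Pi.single c 1) b • X c‖ ≤ B₀ * t := by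
  obtain ⟨c₀⟩ := hne
  refine ⟨fun X t hX b => ?_, fun X t hX b ν => ?_⟩
  · exact supRow_kernelExt F n K D hDk w hw1 H₀ hsup X ((norm_nonneg _).trans (hX c₀)) hX b
  · exact gradRow_kernelExt F n K D hDk w hw2 H₀ hsup X ((norm_nonneg _).trans (hX c₀)) hX b ν

/-- **THE TWO ROWS FOR P2's CANONICAL `flatH`, UNGUARDED** — from the first entry `HSupLetterG F n K D w (flatH F n K D) B₀` of P2's row list `RowsAt` (✓`FlatPortBody.rowsAt_of_adm22`
at the route's families) and the route's level weights: LITERALLY the `hH`∕`hH'` binders of ✓`sliceAndSizes_of_P1rows`. [cite: Balaban1985Variational, (46) p.285, (157)-(158) p.302, (165) p.304] -/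
theorem twoRows_flatH_unguarded (hDk : D.k ≤ K - n) (w : ℕ → PBond (F.P K) 0 → ℝ) (hw : IsLevWeight F n K D w) {B₀ : ℝ}
    (hsup : HSupLetterG F n K D w (flatH F n K D) B₀) (hne : Nonempty (BondIdx D)) :
    (∀ (X : BondIdx D → Matrix (Fin 2) (Fin 2) ℂ) (t : ℝ), (∀ c, ‖X c‖ ≤ t) → ∀ b, w 1 b * ‖∑ c, flatH F n K D (Pi.single c 1) b • X c‖ ≤ B₀ * t) ∧
    ∀ (X : BondIdx D → Matrix (Fin 2) (Fin 2) ℂ) (t : ℝ), (∀ c, ‖X c‖ ≤ t) → ∀ (b : PBond (F.P K) 0) (ν : Fin 3),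
      w 2 b * (F.L : ℝ) ^ (K - n) * ‖(∑ c, flatH F n K D (Pi.single c 1) ⟨b.src.shift ν, b.dir⟩ • X c) - ∑ c, flatH F n K D (Pi.single c 1) b • X c‖ ≤ B₀ * t :=
  twoRows_kernelExt_unguarded F n K D hDk w (fun b => levWeight_nonneg hw 1 b) (fun b => levWeight_nonneg hw 2 b) (flatH F n K D) hsup hne

/-- **THE BUNDLED `hH` SHAPE OF `FlatProp4Dressing.hWq_of_dressing`∕`exists_dressed_gradient_T3`** (one hypothesis giving both rows as a conjunction per datum) for the ℂ-linear kernel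
extension of `flatH`, whenever that extension is presented as a map `Hk` with `Hk X b = Σ_c (flatH e_c)(b)•X c`. [cite: Balaban1985Variational, (46) p.285, (80)-(89) pp.290-291] -/
theorem hH_dressingShape_flatH (hDk : D.k ≤ K - n) (w : ℕ → PBond (F.P K) 0 → ℝ) (hw : IsLevWeight F n K D w) {B₀ : ℝ}
    (hsup : HSupLetterG F n K D w (flatH F n K D) B₀) (hne : Nonempty (BondIdx D))
    (Hk : (BondIdx D → Matrix (Fin 2) (Fin 2) ℂ) → PBond (F.P K) 0 → Matrix (Fin 2) (Fin 2) ℂ)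
    (hHk : ∀ X b, Hk X b = ∑ c, flatH F n K D (Pi.single c 1) b • X c) :
    ∀ (X : BondIdx D → Matrix (Fin 2) (Fin 2) ℂ) (t : ℝ), (∀ c, ‖X c‖ ≤ t) →
      (∀ b, w 1 b * ‖Hk X b‖ ≤ B₀ * t) ∧
      ∀ (b : PBond (F.P K) 0) (ν : Fin 3), w 2 b * (F.L : ℝ) ^ (K - n) * ‖Hk X ⟨b.src.shift ν, b.dir⟩ - Hk X b‖ ≤ B₀ * t := by
  obtain ⟨h1, h2⟩ := twoRows_flatH_unguarded F n K D hDk w hw hsup hne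
  intro X t hX
  refine ⟨fun b => ?_, fun b ν => ?_⟩
  · rw [hHk]; exact h1 X t hX b
  · rw [hHk, hHk]; exact h2 X t hX b ν

end Summit.QuantumFields.YangMills.Theorems.FlatHDressingShape

end
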